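import Literature.Barriers.CriticalPhenomena.SAPAnisotropicNotDFinite242Hadamard
import Literature.Barriers.CriticalPhenomena.SAPAnisotropicNotDFinite242RecurrenceProofs
import HarnessLib

/-!
# 2-4-2 polygons and building blocks as canonical SAP words

Proofs companion (first part) of
`Literature/Barriers/CriticalPhenomena/SAPAnisotropicNotDFinite242Hadamard.lean` (A. Rechnitzer,
*Haruspicy 2*, J. Combin. Theory Ser. A 113 (2006) 520–546, arXiv:math/0406450v2, §3.3), towards
the discharge of its named fact `Rechnitzer2006_lem23` (Lemma 23: the seed / building-block
decomposition of 2-4-2 polygons). The counts `rooted242Count`, `rootedBBCount` of that file live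
in the rooted-walk model (pairs of a neighbour `e` of `0` and a self-avoiding walk `0 → e` of
`zdGraph 2`); the combinatorics of Lemma 23 is carried out on the closed self-avoiding step words
of `SAPWords` / `SAPCanonical` (`Haruspicy.IsSAP`, `Haruspicy.IsCanon`, the `2N`-to-one
correspondence `Haruspicy.card_sapWords_eq`). This file transports the 2-4-2 statistics:

* `Haruspicy.bonds w` — the bonds `(vtx w i, vtx w (i+1))`, `i < |w|`, of a word; for the word of
  a rooted polygon this is a permutation of `polygonBonds` (`perm_bonds_close_ofWalk`), and the
  statistics `yMin`, `yMax`, `rowVerticalBonds`, `bottomWidth`, `topWidth`, `Is242` only depend on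
  the bond list up to permutation (`yMin_congr`, …, `is242_congr`);
* `card_filter_rooted_eq_card_filter_sapWords` — the bijection of `rootedPolygonCount_eq_card_sapWords`
  refined by any permutation-invariant statistic of the bonds; whence `rooted242Count_eq_card`,
  `rootedBBCount_eq_card`;
* `card_filter_sapWords_eq` — the `2N`-to-one correspondence for rotation- and reversal-invariant
  predicates; the bond statistics are such (`bonds_rotate`, `bonds_rev`, `is242_bonds_rotate`, …);
* `p242Count_eq_card_c242Words`, `bbCount_eq_card_bbWords` — `p^{242}_k(m,w)` and `bb(M,t,w)` are
  numbers of canonical words (`c242Words`, `bbWords`).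

[folklore] throughout (elementary combinatorics of lattice walks), on the definitions of
[Rechnitzer2006Haruspicy2] (Definition 18, Lemma 21, Lemma 23) and [MadrasSlade1993] (eq. (3.2.1)).
-/

noncomputable section

open Finset Literature.Probability.LatticeModels Literature.Probability.Percolation
open scoped BigOperators

namespace Literature.Barriers.CriticalPhenomena

namespace Haruspicy

open Edwards2D

/-! ### Bonds of a word -/

/-- The bonds of a step word read from the origin: `(vtx w i, vtx w (i+1))` for `i < |w|`.
[cite: MadrasSlade1993, Definition 3.2.1] -/
def bonds (w : List (Fin 4)) : List (Site 2 × Site 2) :=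
  (List.range w.length).map fun i => (vtx w i, vtx w (i + 1))

/-- `bonds w` has `|w|` entries. [folklore] -/
@[simp] theorem length_bonds (w : List (Fin 4)) : (bonds w).length = w.length := by
  simp [bonds]

/-- The `i`-th bond. [folklore] -/
theorem getElem_bonds (w : List (Fin 4)) {i : ℕ} (hi : i < (bonds w).length) :
    (bonds w)[i] = (vtx w i, vtx w (i + 1)) := by
  simp [bonds]

/-- Membership in `bonds`. [folklore] -/
theorem mem_bonds {w : List (Fin 4)} {b : Site 2 × Site 2} :
    b ∈ bonds w ↔ ∃ i < w.length, (vtx w i, vtx w (i + 1)) = b := by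
  simp [bonds]

/-- The word of a rooted polygon `(e, ω)` has the bonds of `polygonBonds ω`, up to order.
[cite: MadrasSlade1993, Definition 3.2.1] -/
theorem perm_bonds_close_ofWalk {e : Site 2} (p : (zdGraph 2).Walk (0 : Site 2) e) {M : ℕ}
    (hp : p.length = M) (he : (zdGraph 2).Adj e 0) :
    (bonds (close (ofWalk p M))).Perm (polygonBonds p) := by
  have hend : endpoint (ofWalk p M) = e := endpoint_ofWalk p hp
  have hsum : ((close (ofWalk p M)).map stepVec).sum = 0 := sum_map_close (by rw [hend]; exact he)
  have hb : bonds (close (ofWalk p M)) = p.darts.map SimpleGraph.Dart.toProd ++ [(e, 0)] := by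
    rw [bonds, length_close, List.range_succ, List.map_append, List.map_singleton, map_toProd_darts,
      hp]
    congr 1
    · refine List.map_congr_left fun i hi => ?_
      rw [List.mem_range] at hi
      rw [vtx_close _ hi.le, vtx_close _ hi, pos_ofWalk p hp i hi.le, pos_ofWalk p hp (i + 1) hi]
    · rw [vtx_close _ le_rfl, pos_ofWalk p hp M le_rfl, ← hp, SimpleGraph.Walk.getVert_length,
        show p.length + 1 = (close (ofWalk p p.length)).length by rw [length_close], vtx_length,
        hp, hsum]
  rw [hb, polygonBonds]
  exact List.perm_append_singleton _ _

/-! ### The bond statistics only depend on the bonds up to order -/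

/-- `foldr min a` only depends on the members. [folklore] -/
theorem foldr_min_congr {l₁ l₂ : List ℤ} (h : ∀ x, x ∈ l₁ ↔ x ∈ l₂) (a : ℤ) :
    l₁.foldr min a = l₂.foldr min a := by
  have key : ∀ {l₁ l₂ : List ℤ}, (∀ x, x ∈ l₁ ↔ x ∈ l₂) → l₁.foldr min a ≤ l₂.foldr min a := by
    intro l₁ l₂ h
    rcases foldr_min_mem a l₂ with h2 | h2
    · rw [h2]; exact foldr_min_le_init _ _
    · exact foldr_min_le_of_mem ((h _).2 h2)
  exact le_antisymm (key h) (key fun x => (h x).symm)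

/-- `foldr max a` only depends on the members. [folklore] -/
theorem foldr_max_congr {l₁ l₂ : List ℤ} (h : ∀ x, x ∈ l₁ ↔ x ∈ l₂) (a : ℤ) :
    l₁.foldr max a = l₂.foldr max a := by
  have key : ∀ {l₁ l₂ : List ℤ}, (∀ x, x ∈ l₁ ↔ x ∈ l₂) → l₁.foldr max a ≤ l₂.foldr max a := by
    intro l₁ l₂ h
    rcases foldr_max_mem a l₁ with h1 | h1
    · rw [h1]; exact le_foldr_max_init _ _
    · exact le_foldr_max_of_mem ((h _).1 h1)
  exact le_antisymm (key h) (key fun x => (h x).symm)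

variable {L₁ L₂ : List (Site 2 × Site 2)}

/-- `yMin` is invariant under permutations of the bonds. [folklore] -/
theorem yMin_congr (h : L₁.Perm L₂) : yMin L₁ = yMin L₂ :=
  foldr_min_congr (fun _ => (h.map _).mem_iff) 0

/-- `yMax` is invariant under permutations of the bonds. [folklore] -/
theorem yMax_congr (h : L₁.Perm L₂) : yMax L₁ = yMax L₂ :=
  foldr_max_congr (fun _ => (h.map _).mem_iff) 0

/-- `rowVerticalBonds` is invariant under permutations of the bonds. [folklore] -/
theorem rowVerticalBonds_congr (h : L₁.Perm L₂) (r : ℤ) :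
    rowVerticalBonds L₁ r = rowVerticalBonds L₂ r :=
  h.countP_eq _

/-- `bottomWidth` is invariant under permutations of the bonds. [folklore] -/
theorem bottomWidth_congr (h : L₁.Perm L₂) : bottomWidth L₁ = bottomWidth L₂ := by
  rw [bottomWidth, bottomWidth, yMin_congr h]
  exact h.countP_eq _

/-- `topWidth` is invariant under permutations of the bonds. [folklore] -/
theorem topWidth_congr (h : L₁.Perm L₂) : topWidth L₁ = topWidth L₂ := by
  rw [topWidth, topWidth, yMax_congr h]
  exact h.countP_eq _

/-- `Is242 k` is invariant under permutations of the bonds. [folklore] -/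
theorem is242_congr (h : L₁.Perm L₂) (k : ℕ) : Is242 k L₁ ↔ Is242 k L₂ := by
  unfold Is242
  rw [yMin_congr h, yMax_congr h]
  simp_rw [rowVerticalBonds_congr h]

/-! ### Rooted polygons with a bond statistic are SAP words with that statistic -/

open Classical in
/-- **Rooted polygons are SAP words, statistic by statistic**: for `m + n ≥ 2` and any property
`Φ` of bond lists invariant under permutation, the pairs (`e ∼ 0`, `ω : 0 → e` self-avoiding of
length `2(m+n)-1` with `2m` horizontal bonds) whose `polygonBonds` satisfy `Φ` are as many as the
SAP words of length `2(m+n)` with `2m` horizontal letters whose `bonds` satisfy `Φ` (the bijection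
of `rootedPolygonCount_eq_card_sapWords`). [cite: MadrasSlade1993, Definition 3.2.1 and eq. (3.2.1)] -/
theorem card_filter_rooted_eq_card_filter_sapWords (m n : ℕ) (hmn : 2 ≤ m + n)
    (Φ : List (Site 2 × Site 2) → Prop) (hΦ : ∀ L₁ L₂, L₁.Perm L₂ → (Φ L₁ ↔ Φ L₂)) :
    ∑ e ∈ (zdGraph 2).neighborFinset 0,
      (((zdGraph 2).finsetWalkLength (2 * (m + n) - 1) (0 : Site 2) e).filter
        fun p => p.IsPath ∧ horizontalSteps p + (if e 1 = 0 then 1 else 0) = 2 * m ∧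
          Φ (polygonBonds p)).card =
    ((sapWords (2 * (m + n)) (2 * m)).filter fun w => Φ (bonds w)).card := by
  -- `N = 2(m+n) = M + 1`
  obtain ⟨M, hM⟩ : ∃ M, 2 * (m + n) = M + 1 := ⟨2 * (m + n) - 1, by omega⟩
  have hM' : 2 * (m + n) - 1 = M := by omega
  rw [hM', hM, ← Finset.card_sigma]
  refine Finset.card_nbij' (fun s => close (ofWalk s.2 M))
    (fun w => ⟨endpoint (unclose w : StepSeq M), toWalk (unclose w : StepSeq M)⟩) ?_ ?_ ?_ ?_
  · -- forward map lands in SAP words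
    rintro ⟨e, p⟩ hs
    simp only [Finset.mem_coe, Finset.mem_sigma, Finset.mem_filter, SimpleGraph.mem_finsetWalkLength_iff,
      SimpleGraph.mem_neighborFinset] at hs
    obtain ⟨he, hp, hpath, hhor, hΦp⟩ := hs
    have hend : endpoint (ofWalk p M) = e := endpoint_ofWalk p hp
    have hadj : (zdGraph 2).Adj (endpoint (ofWalk p M)) 0 := by rw [hend]; exact he.symm
    rw [Finset.mem_coe, Finset.mem_filter, mem_sapWords]
    refine ⟨⟨length_close _, ⟨by rw [length_close]; omega, sum_map_close hadj, ?_⟩, ?_⟩,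
      (hΦ _ _ (perm_bonds_close_ofWalk p hp he.symm)).2 hΦp⟩
    · intro i hi j hj hij
      simp only [Set.mem_Iio, length_close] at hi hj
      rw [vtx_close _ (by omega), vtx_close _ (by omega), pos_ofWalk p hp i (by omega),
        pos_ofWalk p hp j (by omega)] at hij
      exact hpath.getVert_injOn (by simp [hp]; omega) (by simp [hp]; omega) hij
    · rw [hcount_close, ← hhor]
      have h1 : horizontalSteps (toWalk (ofWalk p M)) = horizontalSteps p := by
        conv_rhs => rw [← toWalk_ofWalk p hp]
        rw [horizontalSteps_copy]
      have h2 : (stepOf (endpoint (ofWalk p M)) 0).val < 2 ↔ e 1 = 0 := by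
        have he1 : e 1 = endpoint (ofWalk p M) 1 := by rw [hend]
        rw [he1]
        exact (apply_one_eq_zero_iff_of_add_stepVec (add_stepVec_stepOf hadj)).symm
      rw [h1]
      by_cases h3 : e 1 = 0
      · rw [if_pos (h2.2 h3), if_pos h3]
      · rw [if_neg (fun h => h3 (h2.1 h)), if_neg h3]
  · -- backward map lands in the sigma set
    intro w hw
    rw [Finset.mem_coe, Finset.mem_filter, mem_sapWords] at hw
    obtain ⟨⟨hlen, ⟨-, hclosed, hinj⟩, hhc⟩, hΦw⟩ := hw
    have hMle : M ≤ w.length := by omega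
    have hend : endpoint (unclose w : StepSeq M) = vtx w M := endpoint_unclose w hMle
    have hlast : vtx w M + stepVec (w[M]'(by omega)) = 0 := vtx_add_stepVec_last hlen hclosed
    have hadj : (zdGraph 2).Adj (endpoint (unclose w : StepSeq M)) 0 := by
      have := adj_add_stepVec (vtx w M) (w[M]'(by omega))
      rwa [hlast, ← hend] at this
    simp only [Finset.mem_coe, Finset.mem_sigma, Finset.mem_filter, SimpleGraph.mem_finsetWalkLength_iff,
      SimpleGraph.mem_neighborFinset]
    refine ⟨hadj.symm, length_toWalk _, ?_, ?_, ?_⟩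
    · rw [← SimpleGraph.Walk.IsPath.getVert_injOn_iff]
      intro i hi j hj hij
      simp only [Set.mem_setOf_eq, length_toWalk] at hi hj
      rw [getVert_toWalk _ hi, getVert_toWalk _ hj, pos_unclose w hMle hi,
        pos_unclose w hMle hj] at hij
      exact hinj (by simp [hlen]; omega) (by simp [hlen]; omega) hij
    · have h2 : (w[M]'(by omega)).val < 2 ↔ endpoint (unclose w : StepSeq M) 1 = 0 := by
        rw [hend, apply_one_eq_zero_iff_of_add_stepVec hlast]
      rw [horizontalSteps_toWalk, ofFn_unclose w hMle, ← hhc]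
      conv_rhs => rw [← take_append_getElem_last w hlen, hcount_append, hcount_singleton]
      unfold hcount
      by_cases h3 : (w[M]'(by omega)).val < 2
      · rw [if_pos (h2.1 h3), if_pos h3]
      · rw [if_neg (fun h => h3 (h2.2 h)), if_neg h3]
    · have hperm := perm_bonds_close_ofWalk (toWalk (unclose w : StepSeq M)) (length_toWalk _) hadj
      rw [ofWalk_toWalk, close_unclose hlen hclosed] at hperm
      exact (hΦ _ _ hperm).1 hΦw
  · -- left inverse
    rintro ⟨e, p⟩ hs
    simp only [Finset.mem_coe, Finset.mem_sigma, Finset.mem_filter,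
      SimpleGraph.mem_finsetWalkLength_iff] at hs
    have hp : p.length = M := hs.2.1
    show (⟨endpoint (unclose (close (ofWalk p M)) : StepSeq M),
        toWalk (unclose (close (ofWalk p M)) : StepSeq M)⟩ : Σ x, (zdGraph 2).Walk 0 x) = ⟨e, p⟩
    rw [unclose_close]
    exact sigma_eq_of_copy_eq _ _ (endpoint_ofWalk p hp) (toWalk_ofWalk p hp)
  · -- right inverse
    intro w hw
    rw [Finset.mem_coe, Finset.mem_filter, mem_sapWords] at hw
    obtain ⟨⟨hlen, ⟨-, hclosed, -⟩, -⟩, -⟩ := hw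
    simp only [ofWalk_toWalk]
    exact close_unclose hlen hclosed

open Classical in
/-- **Rooted 2-4-2 polygons are SAP words**: `rooted242Count k m w` is the number of SAP words of
length `2(m + 3k - 2)` with `2m` horizontal letters whose bonds form a 2-4-2 polygon with `6k-4`
vertical bonds and bottom row `w`. [cite: Rechnitzer2006Haruspicy2, Definition 18] -/
theorem rooted242Count_eq_card (k m w : ℕ) :
    rooted242Count k m w = ((sapWords (2 * (m + (3 * k - 2))) (2 * m)).filter
      fun W => Is242 k (bonds W) ∧ bottomWidth (bonds W) = w).card := by
  by_cases hmn : m + (3 * k - 2) < 2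
  · rw [rooted242Count, if_pos hmn]
    symm
    rw [Finset.card_eq_zero, Finset.eq_empty_iff_forall_notMem]
    intro W hW
    rw [Finset.mem_filter, mem_sapWords] at hW
    have := hW.1.2.1.1
    omega
  rw [rooted242Count, if_neg hmn]
  have hΦ : ∀ L₁ L₂ : List (Site 2 × Site 2), L₁.Perm L₂ →
      ((Is242 k L₁ ∧ bottomWidth L₁ = w) ↔ (Is242 k L₂ ∧ bottomWidth L₂ = w)) := fun L₁ L₂ h => by
    rw [is242_congr h, bottomWidth_congr h]
  have key := card_filter_rooted_eq_card_filter_sapWords m (3 * k - 2) (not_lt.1 hmn) _ hΦ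
  convert key using 3; (ext; simp only [Finset.mem_filter])

open Classical in
/-- **Rooted building blocks are SAP words**: `rootedBBCount m t w` is the number of SAP words of
length `2(m + 4)` with `2m` horizontal letters whose bonds form a 2-4-2 polygon with `8` vertical
bonds, top row `t` and bottom row `w`. [cite: Rechnitzer2006Haruspicy2, Lemma 21] -/
theorem rootedBBCount_eq_card (m t w : ℕ) :
    rootedBBCount m t w = ((sapWords (2 * (m + 4)) (2 * m)).filter
      fun W => Is242 2 (bonds W) ∧ topWidth (bonds W) = t ∧ bottomWidth (bonds W) = w).card := by
  rw [rootedBBCount]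
  have hΦ : ∀ L₁ L₂ : List (Site 2 × Site 2), L₁.Perm L₂ →
      ((Is242 2 L₁ ∧ topWidth L₁ = t ∧ bottomWidth L₁ = w) ↔
        (Is242 2 L₂ ∧ topWidth L₂ = t ∧ bottomWidth L₂ = w)) := fun L₁ L₂ h => by
    rw [is242_congr h, topWidth_congr h, bottomWidth_congr h]
  have key := card_filter_rooted_eq_card_filter_sapWords m 4 (by omega) _ hΦ
  convert key using 3; (ext; simp only [Finset.mem_filter])

/-! ### The `2N`-to-one correspondence, statistic by statistic -/

/-- **Each polygon with a given statistic is rooted and oriented in exactly `2N` ways**: for a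
property `Φ` of SAP words invariant under re-rooting (`List.rotate`) and reversal (`rev`), the SAP
words of length `N` with `hc` horizontal letters satisfying `Φ` are `2N` times as many as the
canonical ones (the bijection of `card_sapWords_eq`). [cite: MadrasSlade1993, eq. (3.2.1)] -/
theorem card_filter_sapWords_eq (N hc : ℕ) (Φ : List (Fin 4) → Prop) [DecidablePred Φ]
    (hrot : ∀ w : List (Fin 4), IsSAP w → ∀ r < w.length, Φ (w.rotate r) ↔ Φ w)
    (hrev : ∀ w : List (Fin 4), IsSAP w → (Φ (rev w) ↔ Φ w)) :
    ((sapWords N hc).filter Φ).card = 2 * N * ((canonWords N hc).filter Φ).card := by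
  rcases Nat.eq_zero_or_pos N with rfl | hN
  · rw [Nat.mul_zero, Nat.zero_mul, Finset.card_eq_zero, Finset.eq_empty_iff_forall_notMem]
    intro w hw
    rw [Finset.mem_filter, mem_sapWords] at hw
    have := hw.1.2.1.1
    omega
  have key : ((canonWords N hc).filter Φ ×ˢ (Finset.univ : Finset (Fin N × Bool))).card =
      ((sapWords N hc).filter Φ).card := by
    apply Finset.card_nbij' (fun p => (bif p.2.2 then rev p.1 else p.1).rotate p.2.1.val)
      (fun u => (canonOf u, (⟨(N - minIdx u) % N, Nat.mod_lt _ hN⟩, flagOf u)))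
    · -- forward map lands in SAP words satisfying `Φ`
      rintro ⟨c, r, b⟩ hp
      simp only [Finset.mem_coe, Finset.mem_product, Finset.mem_filter, mem_canonWords] at hp
      obtain ⟨⟨⟨hlen, hcan, hhc⟩, hΦc⟩, -⟩ := hp
      have hy : IsSAP (bif b then rev c else c) ∧ (bif b then rev c else c).length = N ∧
          hcount (bif b then rev c else c) = hc ∧ Φ (bif b then rev c else c) := by
        cases b
        · exact ⟨hcan.1, hlen, hhc, hΦc⟩
        · exact ⟨isSAP_rev hcan.1, by rw [cond_true, length_rev, hlen],
            by rw [cond_true, hcount_rev, hhc], by rw [cond_true, hrev c hcan.1]; exact hΦc⟩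
      rw [Finset.mem_coe, Finset.mem_filter, mem_sapWords]
      exact ⟨⟨by rw [List.length_rotate, hy.2.1], hy.1.rotate (by rw [hy.2.1]; exact r.isLt),
        by rw [hcount_rotate, hy.2.2.1]⟩,
        (hrot _ hy.1 _ (by rw [hy.2.1]; exact r.isLt)).2 hy.2.2.2⟩
    · -- backward map lands in the product
      intro u hu
      rw [Finset.mem_coe, Finset.mem_filter, mem_sapWords] at hu
      obtain ⟨⟨hlen, hsap, hhc⟩, hΦu⟩ := hu
      rw [Finset.mem_coe, Finset.mem_product, Finset.mem_filter, mem_canonWords]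
      obtain ⟨h1, h2, h3⟩ := hsap.isCanon_canonOf
      have hs : minIdx u < u.length := (minIdx_spec hsap.length_pos).1
      have hΦc : Φ (canonOf u) := by
        have hrot' : Φ (u.rotate (minIdx u)) := (hrot u hsap _ hs).2 hΦu
        unfold canonOf
        split_ifs with hh
        · exact hrot'
        · exact (hrev _ (hsap.rotate hs)).2 hrot'
      exact ⟨⟨⟨by rw [h2, hlen], h1, by rw [h3, hhc]⟩, hΦc⟩, Finset.mem_univ _⟩
    · -- left inverse
      rintro ⟨c, ⟨r, hr⟩, b⟩ hp
      simp only [Finset.mem_coe, Finset.mem_product, Finset.mem_filter, mem_canonWords] at hp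
      obtain ⟨⟨⟨hlen, hcan, -⟩, -⟩, -⟩ := hp
      have hheadrev : (rev c).head? ≠ some 0 := by
        rw [head?_rev, hcan.getLast?]
        decide
      dsimp only
      cases b
      · obtain ⟨hs, hrot, hfin⟩ := rotate_aux hcan.1 hcan.2.1 hlen hr
        simp only [cond_false]
        refine Prod.ext ?_ (Prod.ext (Fin.ext ?_) ?_)
        · show canonOf (c.rotate r) = c
          rw [canonOf, hs, hrot, if_pos hcan.2.2]
        · show (N - minIdx (c.rotate r)) % N = r
          rw [hs, hfin]
        · show flagOf (c.rotate r) = false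
          rw [flagOf, hs, hrot, hcan.2.2]
          decide
      · obtain ⟨hs, hrot, hfin⟩ := rotate_aux (isSAP_rev hcan.1) (isRooted_rev hcan.1 hcan.2.1)
          (by rw [length_rev, hlen]) hr
        simp only [cond_true]
        refine Prod.ext ?_ (Prod.ext (Fin.ext ?_) ?_)
        · show canonOf ((rev c).rotate r) = c
          rw [canonOf, hs, hrot, if_neg hheadrev, rev_rev]
        · show (N - minIdx ((rev c).rotate r)) % N = r
          rw [hs, hfin]
        · show flagOf ((rev c).rotate r) = true
          rw [flagOf, hs, hrot]
          simpa using hheadrev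
    · -- right inverse
      intro u hu
      rw [Finset.mem_coe, Finset.mem_filter, mem_sapWords] at hu
      obtain ⟨⟨hlen, hsap, -⟩, -⟩ := hu
      simp only [cond_flagOf_canonOf]
      have hs : minIdx u < N := hlen ▸ (minIdx_spec hsap.length_pos).1
      exact rotate_rotate_sub_mod hlen hs
  rw [← key, Finset.card_product, Finset.card_univ, Fintype.card_prod, Fintype.card_fin,
    Fintype.card_bool]
  ring

/-! ### Bonds of re-rooted and reversed words -/

/-- Translating a bond by `v`. [folklore] -/
def shiftBond (v : Site 2) (b : Site 2 × Site 2) : Site 2 × Site 2 := (b.1 + v, b.2 + v)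

variable {w : List (Fin 4)}

/-- The bonds of a re-rooted closed word are the bonds, cyclically permuted and translated by
minus the new root. [folklore] -/
theorem bonds_rotate (hc : (w.map stepVec).sum = 0) {r : ℕ} (hr : r < w.length) :
    bonds (w.rotate r) = ((bonds w).rotate r).map (shiftBond (-vtx w r)) := by
  have hpos : 0 < w.length := by omega
  apply List.ext_getElem
  · simp
  intro i h1 h2
  rw [length_bonds, List.length_rotate] at h1
  rw [getElem_bonds, List.getElem_map, List.getElem_rotate, getElem_bonds,
    vtx_rotate hc hr h1.le, vtx_rotate hc hr h1]
  have e1 : (r + i) % w.length = (i + r) % (bonds w).length := by rw [Nat.add_comm, length_bonds]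
  have e2 : vtx w ((r + (i + 1)) % w.length) = vtx w ((i + r) % (bonds w).length + 1) := by
    rw [length_bonds, ← vtx_mod w hc (show (i + r) % w.length + 1 ≤ w.length from Nat.mod_lt _ hpos),
      Nat.mod_add_mod, show i + r + 1 = r + (i + 1) by omega]
  rw [e1, e2, shiftBond]
  simp only [sub_eq_add_neg]

/-- The bonds of the reversed closed word are the reversed bonds, in reverse order. [folklore] -/
theorem bonds_rev (hc : (w.map stepVec).sum = 0) :
    bonds (rev w) = ((bonds w).map Prod.swap).reverse := by
  apply List.ext_getElem
  · simp
  intro i h1 h2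
  rw [length_bonds, length_rev] at h1
  rw [getElem_bonds, List.getElem_reverse, List.getElem_map, getElem_bonds, vtx_rev, vtx_rev, hc,
    sub_zero, sub_zero, Prod.swap_prod_mk]
  simp only [List.length_map, length_bonds]
  rw [show w.length - 1 - i + 1 = w.length - i by omega,
    show w.length - (i + 1) = w.length - 1 - i by omega]

/-- The sources of the bonds of a word are its vertices `vtx w i`, `i < |w|`. [folklore] -/
theorem mem_map_fst_bonds (f : Site 2 → ℤ) {i : ℕ} (hi : i < w.length) :
    f (vtx w i) ∈ (bonds w).map fun b => f b.1 :=
  List.mem_map.2 ⟨(vtx w i, vtx w (i + 1)), mem_bonds.2 ⟨i, hi, rfl⟩, rfl⟩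

/-- For a closed word the targets of the bonds are the sources of the bonds. [folklore] -/
theorem mem_map_snd_bonds_iff (hc : (w.map stepVec).sum = 0) (f : Site 2 → ℤ) (x : ℤ) :
    (x ∈ (bonds w).map fun b => f b.2) ↔ x ∈ (bonds w).map fun b => f b.1 := by
  simp only [List.mem_map, mem_bonds]
  constructor
  · rintro ⟨b, ⟨i, hi, rfl⟩, rfl⟩
    rcases Nat.lt_or_ge (i + 1) w.length with h | h
    · exact ⟨_, ⟨i + 1, h, rfl⟩, rfl⟩
    · refine ⟨_, ⟨0, by omega, rfl⟩, ?_⟩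
      have : i + 1 = w.length := by omega
      simp only [this, vtx_length, hc, vtx_zero]
  · rintro ⟨b, ⟨i, hi, rfl⟩, rfl⟩
    rcases Nat.eq_zero_or_pos i with rfl | h
    · refine ⟨_, ⟨w.length - 1, by omega, rfl⟩, ?_⟩
      simp only [Nat.sub_add_cancel (show 1 ≤ w.length by omega), vtx_length, hc, vtx_zero]
    · refine ⟨_, ⟨i - 1, by omega, rfl⟩, ?_⟩
      simp only [Nat.sub_add_cancel h]

/-! ### The bond statistics under translation and reversal of the bonds -/

/-- `min` over a translated list containing `0` and `-c`. [folklore] -/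
theorem foldr_min_map_add (l : List ℤ) (c : ℤ) (h0 : (0 : ℤ) ∈ l) (hc : -c ∈ l) :
    (l.map (· + c)).foldr min 0 = l.foldr min 0 + c := by
  have hμ : l.foldr min 0 ∈ l := by
    rcases foldr_min_mem 0 l with h | h
    · rw [h]; exact h0
    · exact h
  refine le_antisymm (foldr_min_le_of_mem (List.mem_map.2 ⟨_, hμ, rfl⟩)) ?_
  rcases foldr_min_mem 0 (l.map (· + c)) with h | h
  · rw [h]
    have := foldr_min_le_of_mem (a := 0) hc
    omega
  · obtain ⟨x, hx, hx'⟩ := List.mem_map.1 h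
    have h1 := foldr_min_le_of_mem (a := 0) hx
    have h2 : x + c = (l.map (· + c)).foldr min 0 := hx'
    omega

/-- `max` over a translated list containing `0` and `-c`. [folklore] -/
theorem foldr_max_map_add (l : List ℤ) (c : ℤ) (h0 : (0 : ℤ) ∈ l) (hc : -c ∈ l) :
    (l.map (· + c)).foldr max 0 = l.foldr max 0 + c := by
  have hμ : l.foldr max 0 ∈ l := by
    rcases foldr_max_mem 0 l with h | h
    · rw [h]; exact h0
    · exact h
  refine le_antisymm ?_ (le_foldr_max_of_mem (List.mem_map.2 ⟨_, hμ, rfl⟩))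
  rcases foldr_max_mem 0 (l.map (· + c)) with h | h
  · rw [h]
    have := le_foldr_max_of_mem (a := 0) hc
    omega
  · obtain ⟨x, hx, hx'⟩ := List.mem_map.1 h
    have h1 := le_foldr_max_of_mem (a := 0) hx
    have h2 : x + c = (l.map (· + c)).foldr max 0 := hx'
    omega

variable {L : List (Site 2 × Site 2)} {v : Site 2}

/-- `yMin` of translated bonds (when `0` and `-v` are ordinates of sources). [folklore] -/
theorem yMin_map_shiftBond (h0 : (0 : ℤ) ∈ L.map fun b => b.1 1)
    (hv : -v 1 ∈ L.map fun b => b.1 1) : yMin (L.map (shiftBond v)) = yMin L + v 1 := by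
  rw [yMin, yMin, List.map_map,
    show (fun b : Site 2 × Site 2 => b.1 1) ∘ shiftBond v = (· + v 1) ∘ fun b => b.1 1 by
      funext b; simp [shiftBond], ← List.map_map]
  exact foldr_min_map_add _ _ h0 hv

/-- `yMax` of translated bonds (when `0` and `-v` are ordinates of sources). [folklore] -/
theorem yMax_map_shiftBond (h0 : (0 : ℤ) ∈ L.map fun b => b.1 1)
    (hv : -v 1 ∈ L.map fun b => b.1 1) : yMax (L.map (shiftBond v)) = yMax L + v 1 := by
  rw [yMax, yMax, List.map_map,
    show (fun b : Site 2 × Site 2 => b.1 1) ∘ shiftBond v = (· + v 1) ∘ fun b => b.1 1 by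
      funext b; simp [shiftBond], ← List.map_map]
  exact foldr_max_map_add _ _ h0 hv

/-- `rowVerticalBonds` of translated bonds. [folklore] -/
theorem rowVerticalBonds_map_shiftBond (L : List (Site 2 × Site 2)) (v : Site 2) (r : ℤ) :
    rowVerticalBonds (L.map (shiftBond v)) r = rowVerticalBonds L (r - v 1) := by
  rw [rowVerticalBonds, rowVerticalBonds, List.countP_map]
  refine List.countP_congr fun b _ => ?_
  simp only [Function.comp_apply, shiftBond, Pi.add_apply, decide_eq_true_eq]
  omega

/-- `bottomWidth` of translated bonds. [folklore] -/
theorem bottomWidth_map_shiftBond (h0 : (0 : ℤ) ∈ L.map fun b => b.1 1)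
    (hv : -v 1 ∈ L.map fun b => b.1 1) : bottomWidth (L.map (shiftBond v)) = bottomWidth L := by
  rw [bottomWidth, bottomWidth, yMin_map_shiftBond h0 hv, List.countP_map]
  refine List.countP_congr fun b _ => ?_
  simp only [Function.comp_apply, shiftBond, Pi.add_apply, decide_eq_true_eq]
  omega

/-- `topWidth` of translated bonds. [folklore] -/
theorem topWidth_map_shiftBond (h0 : (0 : ℤ) ∈ L.map fun b => b.1 1)
    (hv : -v 1 ∈ L.map fun b => b.1 1) : topWidth (L.map (shiftBond v)) = topWidth L := by
  rw [topWidth, topWidth, yMax_map_shiftBond h0 hv, List.countP_map]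
  refine List.countP_congr fun b _ => ?_
  simp only [Function.comp_apply, shiftBond, Pi.add_apply, decide_eq_true_eq]
  omega

/-- `Is242 k` of translated bonds. [folklore] -/
theorem is242_map_shiftBond (h0 : (0 : ℤ) ∈ L.map fun b => b.1 1)
    (hv : -v 1 ∈ L.map fun b => b.1 1) (k : ℕ) : Is242 k (L.map (shiftBond v)) ↔ Is242 k L := by
  unfold Is242
  rw [yMin_map_shiftBond h0 hv, yMax_map_shiftBond h0 hv]
  simp_rw [rowVerticalBonds_map_shiftBond]
  constructor
  · rintro ⟨h1, h2⟩
    refine ⟨by omega, fun i hi => ?_⟩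
    have := h2 i hi
    rwa [show yMin L + v 1 + i - v 1 = yMin L + i by ring] at this
  · rintro ⟨h1, h2⟩
    refine ⟨by omega, fun i hi => ?_⟩
    rw [show yMin L + v 1 + i - v 1 = yMin L + i by ring]
    exact h2 i hi

/-- `rowVerticalBonds` of reversed bonds. [folklore] -/
theorem rowVerticalBonds_map_swap (L : List (Site 2 × Site 2)) (r : ℤ) :
    rowVerticalBonds (L.map Prod.swap) r = rowVerticalBonds L r := by
  rw [rowVerticalBonds, rowVerticalBonds, List.countP_map]
  refine List.countP_congr fun b _ => ?_
  simp only [Function.comp_apply, Prod.fst_swap, Prod.snd_swap, decide_eq_true_eq]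
  omega

/-- `yMin` of the reversed bonds of a closed word. [folklore] -/
theorem yMin_map_swap_bonds (hc : (w.map stepVec).sum = 0) :
    yMin ((bonds w).map Prod.swap) = yMin (bonds w) := by
  rw [yMin, yMin, List.map_map]
  exact foldr_min_congr (fun x => mem_map_snd_bonds_iff hc (fun p => p 1) x) 0

/-- `yMax` of the reversed bonds of a closed word. [folklore] -/
theorem yMax_map_swap_bonds (hc : (w.map stepVec).sum = 0) :
    yMax ((bonds w).map Prod.swap) = yMax (bonds w) := by
  rw [yMax, yMax, List.map_map]
  exact foldr_max_congr (fun x => mem_map_snd_bonds_iff hc (fun p => p 1) x) 0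

/-- `bottomWidth` of the reversed bonds of a closed word. [folklore] -/
theorem bottomWidth_map_swap_bonds (hc : (w.map stepVec).sum = 0) :
    bottomWidth ((bonds w).map Prod.swap) = bottomWidth (bonds w) := by
  rw [bottomWidth, bottomWidth, yMin_map_swap_bonds hc, List.countP_map]
  refine List.countP_congr fun b _ => ?_
  simp only [Function.comp_apply, Prod.fst_swap, Prod.snd_swap, decide_eq_true_eq]
  exact and_comm

/-- `topWidth` of the reversed bonds of a closed word. [folklore] -/
theorem topWidth_map_swap_bonds (hc : (w.map stepVec).sum = 0) :
    topWidth ((bonds w).map Prod.swap) = topWidth (bonds w) := by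
  rw [topWidth, topWidth, yMax_map_swap_bonds hc, List.countP_map]
  refine List.countP_congr fun b _ => ?_
  simp only [Function.comp_apply, Prod.fst_swap, Prod.snd_swap, decide_eq_true_eq]
  exact and_comm

/-- `Is242 k` of the reversed bonds of a closed word. [folklore] -/
theorem is242_map_swap_bonds (hc : (w.map stepVec).sum = 0) (k : ℕ) :
    Is242 k ((bonds w).map Prod.swap) ↔ Is242 k (bonds w) := by
  unfold Is242
  rw [yMin_map_swap_bonds hc, yMax_map_swap_bonds hc]
  simp_rw [rowVerticalBonds_map_swap]

/-! ### The 2-4-2 statistics are invariant under re-rooting and reversal -/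

/-- The side conditions of the translation lemmas for re-rooted bonds. [folklore] -/
theorem mem_rotate_bonds_aux (hr' : 0 < w.length) {r : ℕ} (hr : r < w.length) :
    ((0 : ℤ) ∈ ((bonds w).rotate r).map fun b => b.1 1) ∧
      (-(-vtx w r) 1 ∈ ((bonds w).rotate r).map fun b => b.1 1) := by
  have hperm := (List.rotate_perm (bonds w) r).map fun b => b.1 1
  refine ⟨hperm.mem_iff.2 ?_, hperm.mem_iff.2 ?_⟩
  · have := mem_map_fst_bonds (fun p => p 1) hr'
    rwa [vtx_zero] at this
  · rw [Pi.neg_apply, neg_neg]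
    exact mem_map_fst_bonds (fun p => p 1) hr

/-- `Is242 k` is invariant under re-rooting. [folklore] -/
theorem is242_bonds_rotate (h : IsSAP w) {r : ℕ} (hr : r < w.length) (k : ℕ) :
    Is242 k (bonds (w.rotate r)) ↔ Is242 k (bonds w) := by
  obtain ⟨h0, hv⟩ := mem_rotate_bonds_aux h.length_pos hr
  rw [bonds_rotate h.2.1 hr, is242_map_shiftBond h0 hv, is242_congr (List.rotate_perm _ _)]

/-- `bottomWidth` is invariant under re-rooting. [folklore] -/
theorem bottomWidth_bonds_rotate (h : IsSAP w) {r : ℕ} (hr : r < w.length) :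
    bottomWidth (bonds (w.rotate r)) = bottomWidth (bonds w) := by
  obtain ⟨h0, hv⟩ := mem_rotate_bonds_aux h.length_pos hr
  rw [bonds_rotate h.2.1 hr, bottomWidth_map_shiftBond h0 hv,
    bottomWidth_congr (List.rotate_perm _ _)]

/-- `topWidth` is invariant under re-rooting. [folklore] -/
theorem topWidth_bonds_rotate (h : IsSAP w) {r : ℕ} (hr : r < w.length) :
    topWidth (bonds (w.rotate r)) = topWidth (bonds w) := by
  obtain ⟨h0, hv⟩ := mem_rotate_bonds_aux h.length_pos hr
  rw [bonds_rotate h.2.1 hr, topWidth_map_shiftBond h0 hv, topWidth_congr (List.rotate_perm _ _)]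

/-- `Is242 k` is invariant under reversal. [folklore] -/
theorem is242_bonds_rev (h : IsSAP w) (k : ℕ) : Is242 k (bonds (rev w)) ↔ Is242 k (bonds w) := by
  rw [bonds_rev h.2.1, is242_congr (List.reverse_perm _), is242_map_swap_bonds h.2.1]

/-- `bottomWidth` is invariant under reversal. [folklore] -/
theorem bottomWidth_bonds_rev (h : IsSAP w) :
    bottomWidth (bonds (rev w)) = bottomWidth (bonds w) := by
  rw [bonds_rev h.2.1, bottomWidth_congr (List.reverse_perm _), bottomWidth_map_swap_bonds h.2.1]

/-- `topWidth` is invariant under reversal. [folklore] -/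
theorem topWidth_bonds_rev (h : IsSAP w) : topWidth (bonds (rev w)) = topWidth (bonds w) := by
  rw [bonds_rev h.2.1, topWidth_congr (List.reverse_perm _), topWidth_map_swap_bonds h.2.1]

/-! ### `p^{242}_k(m,w)` and `bb(M,t,w)` count canonical words -/

open Classical in
/-- The canonical words of the 2-4-2 polygons with `6k-4` vertical bonds, horizontal
half-perimeter `m` and bottom row `w`. [cite: Rechnitzer2006Haruspicy2, Definition 18] -/
def c242Words (k m w : ℕ) : Finset (List (Fin 4)) :=
  (canonWords (2 * (m + (3 * k - 2))) (2 * m)).filter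
    fun W => Is242 k (bonds W) ∧ bottomWidth (bonds W) = w

open Classical in
/-- The canonical words of the 2-4-2 building blocks with horizontal half-perimeter `M`, top row
`t` and bottom row `w`. [cite: Rechnitzer2006Haruspicy2, Lemma 21] -/
def bbWords (M t w : ℕ) : Finset (List (Fin 4)) :=
  (canonWords (2 * (M + 4)) (2 * M)).filter
    fun W => Is242 2 (bonds W) ∧ topWidth (bonds W) = t ∧ bottomWidth (bonds W) = w

/-- Membership in `c242Words`. [folklore] -/
theorem mem_c242Words {k m w : ℕ} {W : List (Fin 4)} : W ∈ c242Words k m w ↔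
    W.length = 2 * (m + (3 * k - 2)) ∧ IsCanon W ∧ hcount W = 2 * m ∧ Is242 k (bonds W) ∧
      bottomWidth (bonds W) = w := by
  classical
  simp [c242Words, mem_canonWords, and_assoc]

/-- Membership in `bbWords`. [folklore] -/
theorem mem_bbWords {M t w : ℕ} {W : List (Fin 4)} : W ∈ bbWords M t w ↔
    W.length = 2 * (M + 4) ∧ IsCanon W ∧ hcount W = 2 * M ∧ Is242 2 (bonds W) ∧
      topWidth (bonds W) = t ∧ bottomWidth (bonds W) = w := by
  classical
  simp [bbWords, mem_canonWords, and_assoc]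

open Classical in
/-- **2-4-2 polygons up to translation are canonical words**: `p^{242}_k(m,w) = #c242Words k m w`.
[cite: Rechnitzer2006Haruspicy2, Definition 18 and Lemma 25] -/
theorem p242Count_eq_card_c242Words (k m w : ℕ) : p242Count k m w = (c242Words k m w).card := by
  rw [p242Count, rooted242Count_eq_card, card_filter_sapWords_eq]
  · rcases Nat.eq_zero_or_pos (m + (3 * k - 2)) with h0 | hpos
    · rw [h0]
      simp only [Nat.mul_zero, Nat.zero_mul, Nat.zero_div]
      symm
      rw [Finset.card_eq_zero, Finset.eq_empty_iff_forall_notMem]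
      intro W hW
      rw [mem_c242Words, h0] at hW
      have := hW.2.1.1.1
      omega
    · rw [Nat.mul_div_cancel_left _ (by omega)]
      rfl
  · intro W hW r hr
    rw [is242_bonds_rotate hW hr, bottomWidth_bonds_rotate hW hr]
  · intro W hW
    rw [is242_bonds_rev hW, bottomWidth_bonds_rev hW]

open Classical in
/-- **Building blocks up to translation are canonical words**: `bb(M,t,w) = #bbWords M t w`.
[cite: Rechnitzer2006Haruspicy2, Lemma 21] -/
theorem bbCount_eq_card_bbWords (M t w : ℕ) : bbCount M t w = (bbWords M t w).card := by
  rw [bbCount, rootedBBCount_eq_card, card_filter_sapWords_eq]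
  · rw [Nat.mul_div_cancel_left _ (by omega)]
    rfl
  · intro W hW r hr
    rw [is242_bonds_rotate hW hr, topWidth_bonds_rotate hW hr, bottomWidth_bonds_rotate hW hr]
  · intro W hW
    rw [is242_bonds_rev hW, topWidth_bonds_rev hW, bottomWidth_bonds_rev hW]

end Haruspicy

end Literature.Barriers.CriticalPhenomena
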